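import Literature.NumberTheory.Automorphic.UnitaryGroupTruncatedKernelIntegrableOfRows
import Literature.NumberTheory.Automorphic.UnitaryGroupSiegelRootNormDecay
import Literature.NumberTheory.Automorphic.UnitaryGroupTorusSiegelSet
import Literature.NumberTheory.Automorphic.UnitaryGroupTorusSiegelWindows
import Literature.NumberTheory.Automorphic.UnitaryGroupBorelSiegelSetThin
import Literature.NumberTheory.Automorphic.UnitaryGroupBorelThinSetIntegral
import Literature.NumberTheory.Automorphic.UnitaryGroupTorusThreeRay
import Literature.NumberTheory.Automorphic.UnitaryGroupHeisenbergConjFundamentalDomain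
import Literature.NumberTheory.Automorphic.UnitaryGroupHeisenbergConjThreeFactorHead
import Literature.NumberTheory.Automorphic.LocalTestFunctionTestClass
import HarnessLib

/-!
# `TruncatedKernelIntegrable` on `U(J₃)` from the Siegel set: the closer of the T1-qs law modulo the
# three-factor normal form and the level depth of the dilated fundamental domains

(Arthur, *A trace formula for reductive groups I*, Duke Math. J. 45 (1978), §8; Rogawski, *Automorphic
Representations of Unitary Groups in Three Variables* (1990), §2.2 p. 13: «For `T` sufficiently regular,
`k^T(x)` is integrable over `𝐙G\𝐆`»; Borel, *Introduction aux groupes arithmétiques* (1969), §12–§13.)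

Topic `NumberTheory/Automorphic`; namespace `Literature.NumberTheory.Automorphic.UnitaryGroup`. THEOREMS ONLY
(no definition, no named fact, no instance, no notation, no `sorry`). The TRUNK CLOSER of the T1-qs sub-line
(`TruncatedKernelIntegrable`) of `Cruxes/H413/Lines/F0_T1InnerFormTraceIdentity.lean` (cell
`pub/hodgecm-mathlib`, crux H413): it feeds the row package `hrows` of ★ `truncatedKernelIntegrable_of_rows`
(`UnitaryGroupTruncatedKernelIntegrableOfRows`) with the landed rows

* H9a ★ `exists_torusSiegelSet` — the torus Siegel set `S_T` (closed, torus, polar EXPORT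
  `d₀ = w · z(eˢ)`, `d₁ ∈ W`, COVER `T(𝔸_F) = T(F) · S_T`, LETTERS, BALANCE);
* H9b ★ `exists_isCompact_cover_three` ∕ `isClosed_mul_mul_setOf_adelicVal_mem` ∕
  `mul_mem_mul_mul_setOf_adelicVal_mem` ∕ `mul_mul_subset_thin` ∕ `isClosed_mul_setOf_torusPart` — the Borel
  Siegel set `S = Ω · S_T · K_B`, its cover and its THIN superset, with ★ `exists_isCompact_conj_mem` (the
  joint (P1)) and ★ `exists_isCompact_structure_of_mem_siegel` (the structure clause);
* H10a ★ `setLIntegral_lt_top_of_subset_thinSet` and H10b ★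
  `setLIntegral_rpow_neg_borelHeight_lt_top_of_diagUnit` — integration over the thin set and the ray integral;
* H5b ★ `isFundamentalDomain_borelConj_image` ∕ `exists_isCompact_borelConj_heisFundamentalDomain_subset` — the
  dilated fundamental domains `β⁻¹ 𝓕_N β` of `N(F)`,

* H5b HEAD ★ `exists_isCompact_forall_threeFactor` — re-assembled here with the compact direction set quantified
  FIRST (`exists_isCompact_threeDirections_forall_threeFactor`), as the row package needs it,

with the GLUE (ρ) `ρ(b) ≲ H(b)^{-1/[E:ℚ]}` on the Siegel set (★ `UnitaryGroupSiegelRootNormDecay`). ONE geometric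
input remains a HYPOTHESIS, stated token for token in the letters of ★ `exists_isCompact_forall_threeFactor` (its premise `hval`): the LEVEL
DEPTH `hdepth` of the dilated domains on the Siegel set — for every level `𝔫 ≠ 0` a rational `β ∈ B` with
`π(b⁻¹ u b) ≡ 1 mod 𝔫` at the finite places for all `b ∈ S` of height `≥ 1` and all `u ∈ β⁻¹ 𝓕_N β` (brick
`UnitaryGroupSiegelConjLevelDepth`; by `hval_of_mem_torusConj_image_of_smul_eq` of
`UnitaryGroupHeisenbergConjLevelDilated` it is the choice of a sufficiently divisible `m ∈ F×` for
`β = diag(m⁻¹, 1, m)`, ★ `exists_rational_torus_diag`).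

WHAT IS PROVED.
* `exists_isCompact_threeDirections_forall_threeFactor` — the H5b HEAD with the direction set first;
* **`truncatedKernelIntegrable_of_levelDepth`** (generic quadratic `E/F`, `c² = 1`, `c ≠ 1`, `[E:F] = 2`,
  unimodularity and the Iwasawa decomposition `hBK` as hypotheses) and
  **`truncatedKernelIntegrable_cm_of_levelDepth`** (at `(L⁺, L, complexConj)`, those discharged):
  `TruncatedKernelIntegrable` from `hdepth` alone (GLUE (ρ) and the ray windows: ★
  `exists_rootNorms_le_rpow_of_balance`, ★ `forall_diagUnit_of_export`, `UnitaryGroupSiegelRootNormDecay`).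

## References
* J. Arthur, *A trace formula for reductive groups I*, Duke Math. J. 45 (1978), §8 (pp. 947–950)
  [Arthur1978TraceFormulaI].
* J. D. Rogawski, *Automorphic Representations of Unitary Groups in Three Variables*, Ann. of Math. Stud.
  123 (1990), §2.2 (p. 13) [Rogawski1990].
* A. Borel, *Introduction aux groupes arithmétiques* (1969), §12–§13 [Borel1969].
-/

set_option autoImplicit false

noncomputable section

open MeasureTheory Measure NumberField NumberField.mixedEmbedding IsDedekindDomain Set Topology
open scoped NNReal ENNReal Pointwise MatrixGroups Classical

namespace Literature.NumberTheory.Automorphic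

namespace UnitaryGroup

variable {F E : Type} [Field F] [NumberField F] [Field E] [NumberField E] [Algebra F E]
  {c : E ≃ₐ[F] E}

/-! ## §3 `TruncatedKernelIntegrable` from the three-factor normal form and the level depth -/

/-- `N(𝔸_F)` is closed in `G(𝔸_F)` (plumbing; as in `UnitaryGroupBorelSiegelSetStructure`). [folklore] -/
private theorem isClosed_adelicUnipotent₁₁ :
    IsClosed ((adelicUnipotent F E c 3 : Set (quasiSplit F E c 3).Adelic)) := by
  haveI : T2Space (FiniteAdeleRing (𝓞 E) E) := inferInstanceAs <| T2Space
    (RestrictedProduct (fun w : HeightOneSpectrum (𝓞 E) => w.adicCompletion E)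
      (fun w => (w.adicCompletionIntegers E : Set (w.adicCompletion E))) Filter.cofinite)
  haveI : T2Space (InfiniteAdeleRing E) :=
    inferInstanceAs <| T2Space ((w : InfinitePlace E) → w.Completion)
  haveI : T2Space (AdeleRing (𝓞 E) E) := inferInstanceAs <| T2Space (InfiniteAdeleRing E × FiniteAdeleRing (𝓞 E) E)
  change IsClosed (⇑(adelicVal F E c 3 ((StdForm.antidiagonal 3).over E)) ⁻¹'
    ((upperUnitriangular (Fin 3) (AdeleRing (𝓞 E) E) : Subgroup (GL (Fin 3) (AdeleRing (𝓞 E) E))) :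
      Set (GL (Fin 3) (AdeleRing (𝓞 E) E))))
  exact (isClosed_upperUnitriangular (R := AdeleRing (𝓞 E) E)).preimage continuous_subtype_val

/-- **THE THREE-FACTOR NORMAL FORM WITH THE DIRECTION SET FIRST** (row H5b HEAD ★
`exists_isCompact_forall_threeFactor`, re-assembled with its compact set of directions — the unit multiples of
`Ad(κ⁻¹)E_{ij}`, `κ ∈ K_∞`, `(i,j) ∈ {(0,2),(0,1),(1,2)}`, ★ `isCompact_threeDirections` — quantified BEFORE the
compacta `K_N, Ω ⊆ N(𝔸_F)`: the row package `hrows` of ★ `truncatedKernelIntegrable_of_rows` fixes the direction set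
once, while `K_N = W₀(U)` varies with the level).  For compact `K_N, Ω` there is `C ≥ 0` such that for `b ∈ B(𝔸_F)`
with unipotent part in `Ω`, `π k ∈ K_∞ · GL₃(𝒪̂_E)`, a level `𝔫` and `u ∈ K_N` with `π(b⁻¹ub) ≡ 1 mod 𝔫` at the finite
places: `π((bk)⁻¹ u (bk)) = ι_∞(expGL(t₁•X₁) expGL(t₂•X₂) expGL(t₃•X₃)) · w`, `Xᵢ ∈ S`, `w ∈ K(𝔫)`,
`|tᵢ| ≤ C · ρ(d)` (★ `exists_forall_norm_archParam_le`, ★ `exists_real_params_three`, ★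
`ofFinite_conj_sndHom_mem_principalCongruenceLevel`, ★ `adelicVal_borel_mul_conj_eq_threeFactor` — A-p13 (g23)'s
proof of the HEAD, verbatim after the reordering). [cite: Rogawski1990, §2.2 (p. 13)] [cite: Arthur1978TraceFormulaI, §7] -/
theorem exists_isCompact_threeDirections_forall_threeFactor (hc : c * c = 1) :
    ∃ S : Set (Matrix (Fin 3) (Fin 3) (mixedSpace E)), IsCompact S ∧
      ∀ {KN Ω : Set (adelicUnipotent F E c 3)}, IsCompact KN → IsCompact Ω → ∃ C : ℝ, 0 ≤ C ∧
      ∀ (b : borelAdelic F E c 3) (k : (quasiSplit F E c 3).Adelic),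
        adelicVal F E c 3 _ k ∈ standardMaximalCompactGL 3 E →
        (⟨(((torusPart b)⁻¹ * b : borelAdelic F E c 3) : (quasiSplit F E c 3).Adelic),
            torusPart_inv_mul_mem_adelicUnipotent b⟩ : adelicUnipotent F E c 3) ∈ Ω →
        ∀ 𝔫 : Ideal (𝓞 E), ∀ u ∈ KN,
          (∀ i j : Fin 3, i ≠ j → ∀ v : HeightOneSpectrum (𝓞 E),
            Valued.v ((((adelicVal F E c 3 _ ((b : (quasiSplit F E c 3).Adelic)⁻¹ *
                (u : (quasiSplit F E c 3).Adelic) * (b : (quasiSplit F E c 3).Adelic)) :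
              GL (Fin 3) (AdeleRing (𝓞 E) E)) : Matrix (Fin 3) (Fin 3) (AdeleRing (𝓞 E) E)) i j).2 v) ≤
                idealRadius E v 𝔫 ∧
            Valued.v ((conjAdele F E c (((adelicVal F E c 3 _ ((b : (quasiSplit F E c 3).Adelic)⁻¹ *
                (u : (quasiSplit F E c 3).Adelic) * (b : (quasiSplit F E c 3).Adelic)) :
              GL (Fin 3) (AdeleRing (𝓞 E) E)) : Matrix (Fin 3) (Fin 3) (AdeleRing (𝓞 E) E)) i j)).2 v) ≤
                idealRadius E v 𝔫) →
          ∃ (t₁ t₂ t₃ : ℝ) (X₁ X₂ X₃ : Matrix (Fin 3) (Fin 3) (mixedSpace E))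
            (w : GL (Fin 3) (AdeleRing (𝓞 E) E)),
            X₁ ∈ S ∧ X₂ ∈ S ∧ X₃ ∈ S ∧ w ∈ principalCongruenceLevel 3 E 𝔫 ∧
            |t₁| ≤ C * max (max ‖archHom E ((((diagUnit b.2 0)⁻¹ * diagUnit b.2 1 : (AdeleRing (𝓞 E) E)ˣ)) : AdeleRing (𝓞 E) E)‖
              ‖archHom E ((((diagUnit b.2 0)⁻¹ * diagUnit b.2 2 : (AdeleRing (𝓞 E) E)ˣ)) : AdeleRing (𝓞 E) E)‖)
              ‖archHom E ((((diagUnit b.2 1)⁻¹ * diagUnit b.2 2 : (AdeleRing (𝓞 E) E)ˣ)) : AdeleRing (𝓞 E) E)‖ ∧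
            |t₂| ≤ C * max (max ‖archHom E ((((diagUnit b.2 0)⁻¹ * diagUnit b.2 1 : (AdeleRing (𝓞 E) E)ˣ)) : AdeleRing (𝓞 E) E)‖
              ‖archHom E ((((diagUnit b.2 0)⁻¹ * diagUnit b.2 2 : (AdeleRing (𝓞 E) E)ˣ)) : AdeleRing (𝓞 E) E)‖)
              ‖archHom E ((((diagUnit b.2 1)⁻¹ * diagUnit b.2 2 : (AdeleRing (𝓞 E) E)ˣ)) : AdeleRing (𝓞 E) E)‖ ∧
            |t₃| ≤ C * max (max ‖archHom E ((((diagUnit b.2 0)⁻¹ * diagUnit b.2 1 : (AdeleRing (𝓞 E) E)ˣ)) : AdeleRing (𝓞 E) E)‖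
              ‖archHom E ((((diagUnit b.2 0)⁻¹ * diagUnit b.2 2 : (AdeleRing (𝓞 E) E)ˣ)) : AdeleRing (𝓞 E) E)‖)
              ‖archHom E ((((diagUnit b.2 1)⁻¹ * diagUnit b.2 2 : (AdeleRing (𝓞 E) E)ˣ)) : AdeleRing (𝓞 E) E)‖ ∧
            adelicVal F E c 3 _ (((b : (quasiSplit F E c 3).Adelic) * k)⁻¹ * (u : (quasiSplit F E c 3).Adelic) *
                ((b : (quasiSplit F E c 3).Adelic) * k)) =
              GLn.ofInfinite 3 E (expGL (t₁ • X₁) * expGL (t₂ • X₂) * expGL (t₃ • X₃)) * w := by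
  refine ⟨{X : Matrix (Fin 3) (Fin 3) (mixedSpace E) |
        ∃ κ ∈ (Kinf 3 E : Set (GL (Fin 3) (mixedSpace E))), ∃ a : mixedSpace E, ‖a‖ ≤ 1 ∧
          ∃ p ∈ ({((0 : Fin 3), (2 : Fin 3)), (0, 1), (1, 2)} : Set (Fin 3 × Fin 3)),
            X = a • ((((κ⁻¹ : GL (Fin 3) (mixedSpace E)) : Matrix (Fin 3) (Fin 3) (mixedSpace E)) *
              Matrix.single p.1 p.2 1 * (κ : Matrix (Fin 3) (Fin 3) (mixedSpace E))))},
    isCompact_threeDirections (isCompact_Kinf_holds 3 E), fun {KN} {Ω} hKN hΩ => ?_⟩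
  obtain ⟨C, hC0, hC⟩ := exists_forall_norm_archParam_le (F := F) (E := E) (c := c) hc hKN hΩ
  refine ⟨C, hC0, ?_⟩
  intro b k hk hn₀ 𝔫 u hu hval
  obtain ⟨κ, hκ, κf, hκf, hkeq⟩ := exists_ofInfinite_mul_ofFinite_of_mem_standardMaximalCompactGL hk
  obtain ⟨h₁, h₂, h₃⟩ := hC b hn₀ u hu
  have hp₁ : ((0 : Fin 3), (2 : Fin 3)) ∈ ({((0 : Fin 3), (2 : Fin 3)), (0, 1), (1, 2)} : Set (Fin 3 × Fin 3)) := by simp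
  have hp₂ : ((0 : Fin 3), (1 : Fin 3)) ∈ ({((0 : Fin 3), (2 : Fin 3)), (0, 1), (1, 2)} : Set (Fin 3 × Fin 3)) := by simp
  have hp₃ : ((1 : Fin 3), (2 : Fin 3)) ∈ ({((0 : Fin 3), (2 : Fin 3)), (0, 1), (1, 2)} : Set (Fin 3 × Fin 3)) := by simp
  obtain ⟨t₁, t₂, t₃, X₁, X₂, X₃, hX₁, hX₂, hX₃, ht₁, ht₂, ht₃, e⟩ :=
    exists_real_params_three (Kc := (Kinf 3 E : Set (GL (Fin 3) (mixedSpace E)))) hκ h₁ h₂ h₃ hp₁ hp₂ hp₃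
  refine ⟨t₁, t₂, t₃, X₁, X₂, X₃,
    GLn.ofFinite 3 E (κf⁻¹ * GLn.sndHom 3 E (adelicVal F E c 3 _
      ((b : (quasiSplit F E c 3).Adelic)⁻¹ * (u : (quasiSplit F E c 3).Adelic) * (b : (quasiSplit F E c 3).Adelic))) * κf),
    hX₁, hX₂, hX₃, ?_, ht₁, ht₂, ht₃, ?_⟩
  · exact ofFinite_conj_sndHom_mem_principalCongruenceLevel hc
      ⟨(b : (quasiSplit F E c 3).Adelic)⁻¹ * (u : (quasiSplit F E c 3).Adelic) * (b : (quasiSplit F E c 3).Adelic),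
                borel_inv_mul_mul_mem_adelicUnipotent b u⟩ 𝔫 hval hκf
  · exact (adelicVal_borel_mul_conj_eq_threeFactor hc b k κ κf hkeq u).trans (congrArg (fun M : GL (Fin 3) (mixedSpace E) =>
      GLn.ofInfinite 3 E M * GLn.ofFinite 3 E (κf⁻¹ * GLn.sndHom 3 E (adelicVal F E c 3 _
        ((b : (quasiSplit F E c 3).Adelic)⁻¹ * (u : (quasiSplit F E c 3).Adelic) * (b : (quasiSplit F E c 3).Adelic))) * κf)) e)

/-- **`TruncatedKernelIntegrable F E c` FROM THE THREE-FACTOR NORMAL FORM AND THE LEVEL DEPTH** (generic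
quadratic `E/F` with `c² = 1`, `c ≠ 1`, `[E:F] = 2`; unimodularity of `G(𝔸_F)` and the adelic Iwasawa decomposition
`hBK` as hypotheses).  The Siegel set `S = Ω · S_T · (B ∩ K_U)` (rows H9a, H9b), its structure clause, the GLUE (ρ)
(§1), the thin-set integration (row H10a) over the ray (row H10b, §2) and the dilated fundamental domains
``β⁻¹ 𝓕_N β` and the three-factor normal form (directions first) are assembled into the row package of ★
`truncatedKernelIntegrable_of_rows`; the one remaining input is the hypothesis `hdepth` — for every level `𝔫 ≠ 0`
a rational `β ∈ B` such that `π(b⁻¹ub) ≡ 1 mod 𝔫` at the finite places for all `b ∈ S` of height `≥ 1` and all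
`u ∈ β⁻¹ 𝓕_N β`. [cite: Arthur1978TraceFormulaI, §8 (pp. 947–950)]
[cite: Rogawski1990, §2.2 (p. 13)] [cite: Borel1969, §13.1] -/
theorem truncatedKernelIntegrable_of_levelDepth (hc : c * c = 1) (hc1 : c ≠ 1)
    (h2 : Module.finrank F E = 2)
    (hunimod : ∀ [MeasurableSpace (quasiSplit F E c 3).Adelic] [BorelSpace (quasiSplit F E c 3).Adelic]
      (νG : Measure (quasiSplit F E c 3).Adelic), νG.IsHaarMeasure → νG.IsMulRightInvariant)
    (hBK : ∀ g : (quasiSplit F E c 3).Adelic, ∃ b ∈ borelAdelic F E c 3, ∃ k : (quasiSplit F E c 3).Adelic,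
      adelicVal F E c 3 ((StdForm.antidiagonal 3).over E) k ∈ standardMaximalCompactGL 3 E ∧ g = b * k)
    (hdepth : ∀ {Ω ST : Set (borelAdelic F E c 3)}, IsCompact Ω → ∀ {W : Set (AdeleRing (𝓞 E) E)ˣ},
      IsCompact W → (∀ t ∈ ST, torusPart t = t) →
      (∀ t ∈ ST, ∃ w ∈ W, ∃ r : ℝ≥0ˣ, diagUnit t.2 0 = w * posRealIdele E r ∧ diagUnit t.2 1 ∈ W) →
      ∀ {𝔫 : Ideal (𝓞 E)}, 𝔫 ≠ 0 →
      ∃ β : borelAdelic F E c 3, (β : (quasiSplit F E c 3).Adelic) ∈ (quasiSplit F E c 3).arithmeticSubgroup ∧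
        ∀ b ∈ Ω * ST * {k : borelAdelic F E c 3 |
            adelicVal F E c 3 ((StdForm.antidiagonal 3).over E) (k : (quasiSplit F E c 3).Adelic) ∈
              standardMaximalCompactGL 3 E},
        1 ≤ borelHeight (b : (quasiSplit F E c 3).Adelic) →
        ∀ u ∈ (fun v : adelicUnipotent F E c 3 =>
            (⟨(β : (quasiSplit F E c 3).Adelic)⁻¹ * (v : (quasiSplit F E c 3).Adelic) * (β : (quasiSplit F E c 3).Adelic),
              borel_inv_mul_mul_mem_adelicUnipotent β v⟩ : adelicUnipotent F E c 3)) '' heisFundamentalDomain F E c hc,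
          ∀ i j : Fin 3, i ≠ j → ∀ v : HeightOneSpectrum (𝓞 E),
            Valued.v ((((adelicVal F E c 3 _ ((b : (quasiSplit F E c 3).Adelic)⁻¹ *
                (u : (quasiSplit F E c 3).Adelic) * (b : (quasiSplit F E c 3).Adelic)) :
              GL (Fin 3) (AdeleRing (𝓞 E) E)) : Matrix (Fin 3) (Fin 3) (AdeleRing (𝓞 E) E)) i j).2 v) ≤
                idealRadius E v 𝔫 ∧
            Valued.v ((conjAdele F E c (((adelicVal F E c 3 _ ((b : (quasiSplit F E c 3).Adelic)⁻¹ *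
                (u : (quasiSplit F E c 3).Adelic) * (b : (quasiSplit F E c 3).Adelic)) :
              GL (Fin 3) (AdeleRing (𝓞 E) E)) : Matrix (Fin 3) (Fin 3) (AdeleRing (𝓞 E) E)) i j)).2 v) ≤
                idealRadius E v 𝔫) :
    TruncatedKernelIntegrable F E c := by
  classical
  -- row H9a: the torus Siegel set
  obtain ⟨ST, W, hSTc, hWc, hSTt, hexp, hSTcov, ⟨R₁, R₂, hR₁, hR₂, hR⟩, ⟨κ, hbal⟩⟩ :=
    exists_torusSiegelSet F E c h2 hc1
  have hexp' : ∀ t ∈ ST, ∃ w ∈ W, ∃ r : ℝ≥0ˣ, diagUnit t.2 0 = w * posRealIdele E r ∧ diagUnit t.2 1 ∈ W :=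
    fun t ht => by
      obtain ⟨w, hw, s, h0, h1, -, -⟩ := hexp t ht
      exact ⟨w, hw, _, h0, h1⟩
  have hexp'' : ∀ t ∈ ST, ∃ w ∈ W, ∃ s : ℝ,
      diagUnit t.2 0 = w * posRealIdele E (expUnitNNReal s) ∧ diagUnit t.2 1 ∈ W :=
    fun t ht => by
      obtain ⟨w, hw, s, h0, h1, -, -⟩ := hexp t ht
      exact ⟨w, hw, s, h0, h1⟩
  -- row H9b: `Ω`, the Siegel set `S = Ω · S_T · K_B` and the cover
  obtain ⟨Ω, hΩc, hΩN, hcov⟩ := exists_isCompact_cover_three hc hBK hSTcov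
  set KB : Set (borelAdelic F E c 3) := {k : borelAdelic F E c 3 |
    adelicVal F E c 3 ((StdForm.antidiagonal 3).over E) (k : (quasiSplit F E c 3).Adelic) ∈
      standardMaximalCompactGL 3 E} with hKB
  set S : Set (borelAdelic F E c 3) := Ω * ST * KB with hS
  -- the structure clause (★ `exists_isCompact_structure_of_mem_siegel` with the LETTERS of row H9a)
  obtain ⟨ΩG, hΩGc, R₁', R₂', hR₁'c, hR₂'c, hSred⟩ := exists_isCompact_structure_of_mem_siegel hc hΩc hΩN hSTt
    hR₁ hR₂ (fun t ht h1 => (hR t ht h1).1) (fun t ht h1 => (hR t ht h1).2)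
  -- the thin superset (★ joint (P1) + ★ `mul_mul_subset_thin`)
  obtain ⟨CN, hCNc, hCNN, hCN⟩ := exists_isCompact_conj_mem hc hWc hSTt hexp'
  have hthin := mul_mul_subset_thin (Ω := Ω) hΩN hSTt hCN
  obtain ⟨hSTKc, hSTKt, hΩCNc, -⟩ := isClosed_mul_setOf_torusPart hSTc hSTt hΩc hΩN hCNc hCNN
  -- GLUE (ρ) and the ray windows
  obtain ⟨κ', hκ'0, hglue⟩ := exists_rootNorms_le_rpow_of_balance hΩN hSTt hbal
  obtain ⟨hC₀c, hC₁c, hrayS⟩ := forall_diagUnit_of_export hWc hSTt hexp''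
  -- the unipotent window as a compact subset of `N(𝔸_F)`
  set ΩN : Set (adelicUnipotent F E c 3) :=
    (Subtype.val : adelicUnipotent F E c 3 → (quasiSplit F E c 3).Adelic) ⁻¹' ΩG with hΩN'
  have hΩNc : IsCompact ΩN :=
    (isClosed_adelicUnipotent₁₁ (F := F) (E := E) (c := c)).isClosedEmbedding_subtypeVal.isCompact_preimage hΩGc
  -- the direction set of the three-factor normal form, FIXED before the rows are opened
  obtain ⟨Sdir, hSdir, h3⟩ := exists_isCompact_threeDirections_forall_threeFactor (F := F) (E := E) hc
  -- (`apply`, not `refine … ?_`: the row package opens with instance binders)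
  apply truncatedKernelIntegrable_of_rows hc hc1 hunimod hBK hSdir
  intro mN bN mG bG ν hν
  haveI : LocallyCompactSpace (borelAdelic F E c 3) := locallyCompactSpace_borelAdelic
  haveI : T2Space (borelAdelic F E c 3) := t2Space_borelAdelic
  haveI : LocallyCompactSpace (torusInBorel F E c 3) :=
    (isTopSemidirect_borelAdelic (F := F) (E := E) (c := c) (N := 3)).isClosed_left.locallyCompactSpace
  set μB : Measure (borelAdelic F E c 3) := Measure.haar with hμB
  set μT : Measure (torusInBorel F E c 3) := Measure.haar with hμT
  refine ⟨μB, inferInstance, S, ΩG, R₁', R₂', 1, isClosed_mul_mul_setOf_adelicVal_mem hΩc hSTc,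
    mul_mem_mul_mul_setOf_adelicVal_mem, hcov, hΩGc, hR₁'c, hR₂'c, fun b hb hH => hSred b hb hH.le,
    fun U hU => ?_⟩
  -- per level `U`: `𝔫` with `K(𝔫) ≤ U`, the rational `β` of the level depth, `𝓕₀ = β⁻¹ 𝓕_N β ⊆ W₀`
  obtain ⟨𝔫, h𝔫, hKU, -⟩ := exists_principalCongruenceLevel_le_of_mem_finiteLevelsGL hU Filter.univ_mem
  obtain ⟨β, hβ, hval⟩ := hdepth hΩc hWc hSTt hexp' h𝔫
  obtain ⟨W₀, hW₀c, hW₀⟩ := exists_isCompact_borelConj_heisFundamentalDomain_subset hc β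
  obtain ⟨C, hC0, hgeo⟩ := h3 hW₀c hΩNc
  letI : MeasurableSpace (AdeleRing (𝓞 E) E) := borel _
  haveI : BorelSpace (AdeleRing (𝓞 E) E) := ⟨rfl⟩
  refine ⟨(fun v : adelicUnipotent F E c 3 =>
      (⟨(β : (quasiSplit F E c 3).Adelic)⁻¹ * (v : (quasiSplit F E c 3).Adelic) * (β : (quasiSplit F E c 3).Adelic),
        borel_inv_mul_mul_mem_adelicUnipotent β v⟩ : adelicUnipotent F E c 3)) '' heisFundamentalDomain F E c hc,
    W₀, fun b => C * max (max
      ‖archHom E ((((diagUnit b.2 0)⁻¹ * diagUnit b.2 1 : (AdeleRing (𝓞 E) E)ˣ)) : AdeleRing (𝓞 E) E)‖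
      ‖archHom E ((((diagUnit b.2 0)⁻¹ * diagUnit b.2 2 : (AdeleRing (𝓞 E) E)ˣ)) : AdeleRing (𝓞 E) E)‖)
      ‖archHom E ((((diagUnit b.2 1)⁻¹ * diagUnit b.2 2 : (AdeleRing (𝓞 E) E)ˣ)) : AdeleRing (𝓞 E) E)‖,
    isFundamentalDomain_borelConj_image hc β hβ ν, hW₀c, hW₀, ?_, ?_⟩
  · -- `hgeom`: the three-factor normal form on the Siegel set above height `1`
    intro b hb hHb k hk u hu
    have hn₀ : (⟨(((torusPart b)⁻¹ * b : borelAdelic F E c 3) : (quasiSplit F E c 3).Adelic),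
        torusPart_inv_mul_mem_adelicUnipotent b⟩ : adelicUnipotent F E c 3) ∈ ΩN :=
      (hSred b hb hHb.le).1
    obtain ⟨t₁, t₂, t₃, X₁, X₂, X₃, w, hX₁, hX₂, hX₃, hw, ht₁, ht₂, ht₃, e⟩ :=
      hgeo b k hk hn₀ 𝔫 u (hW₀ hu) (hval b hb hHb.le u hu)
    exact ⟨t₁, t₂, t₃, X₁, X₂, X₃, w, hX₁, hX₂, hX₃, hKU hw, ht₁, ht₂, ht₃, e⟩
  · -- `hH10`: thin-set integration (row H10a) of the GLUE (ρ) majorant over the ray (row H10b)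
    have hn0 : (0 : ℝ) < 1 / (Module.finrank ℚ E : ℝ) :=
      div_pos one_pos (by exact_mod_cast Module.finrank_pos)
    have hCκ : 0 ≤ C * κ' := mul_nonneg hC0 hκ'0
    have hgm : Measurable fun x : ℝ≥0 =>
        ENNReal.ofReal (C * κ') * ENNReal.ofReal ((x : ℝ) ^ (-(1 / (Module.finrank ℚ E : ℝ)))) :=
      measurable_const.mul (measurable_coe_nnreal_real.pow_const _).ennreal_ofReal
    refine setLIntegral_lt_top_of_subset_thinSet hc hc1 μB μT
      (isClosed_mul_mul_setOf_adelicVal_mem hΩc hSTc).measurableSet hSTKc.measurableSet hΩCNc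
      (T₀ := 1) (fun b hb _ => hthin hb) hgm (fun b hb hHb => ?_) (fun T hT => ?_)
    · rw [← ENNReal.ofReal_mul hCκ, mul_assoc]
      exact ENNReal.ofReal_le_ofReal (mul_le_mul_of_nonneg_left (hglue b hb hHb.le) hC0)
    · rw [lintegral_const_mul' _ _ ENNReal.ofReal_ne_top]
      exact ENNReal.mul_lt_top ENNReal.ofReal_lt_top
        (setLIntegral_rpow_neg_borelHeight_lt_top_of_diagUnit hc μT hC₀c hC₁c hrayS (lt_trans one_pos hT) hn0)

/-- **`TruncatedKernelIntegrable L⁺ L c` FROM THE THREE-FACTOR NORMAL FORM AND THE LEVEL DEPTH, AT A CM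
EXTENSION** — `c² = 1`, `c ≠ 1`, `[L:L⁺] = 2`, unimodularity (★ `isMulRightInvariant_quasiSplit_cm_three`) and the
adelic Iwasawa decomposition (★ `exists_mem_borelAdelic_mul_mem_standardMaximalCompactGL_cm_three`) DISCHARGED:
the T1-qs named fact for the line's `G = U(Φ₃)` follows from `hdepth` (level depth of the dilated fundamental
domains on the Siegel set) alone. [cite: Arthur1978TraceFormulaI, §8 (pp. 947–950)]
[cite: Rogawski1990, §2.2 (p. 13)] -/
theorem truncatedKernelIntegrable_cm_of_levelDepth (L : Type) [Field L] [NumberField L] [IsCMField L]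
    (hdepth : ∀ {Ω ST : Set (borelAdelic (↥(maximalRealSubfield L)) L (IsCMField.complexConj L) 3)}, IsCompact Ω →
      ∀ {W : Set (AdeleRing (𝓞 L) L)ˣ}, IsCompact W → (∀ t ∈ ST, torusPart t = t) →
      (∀ t ∈ ST, ∃ w ∈ W, ∃ r : ℝ≥0ˣ, diagUnit t.2 0 = w * posRealIdele L r ∧ diagUnit t.2 1 ∈ W) →
      ∀ {𝔫 : Ideal (𝓞 L)}, 𝔫 ≠ 0 →
      ∃ β : borelAdelic (↥(maximalRealSubfield L)) L (IsCMField.complexConj L) 3,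
        (β : (quasiSplit (↥(maximalRealSubfield L)) L (IsCMField.complexConj L) 3).Adelic) ∈
          (quasiSplit (↥(maximalRealSubfield L)) L (IsCMField.complexConj L) 3).arithmeticSubgroup ∧
        ∀ b ∈ Ω * ST * {k : borelAdelic (↥(maximalRealSubfield L)) L (IsCMField.complexConj L) 3 |
            adelicVal (↥(maximalRealSubfield L)) L (IsCMField.complexConj L) 3 ((StdForm.antidiagonal 3).over L)
              (k : (quasiSplit (↥(maximalRealSubfield L)) L (IsCMField.complexConj L) 3).Adelic) ∈
              standardMaximalCompactGL 3 L},
        1 ≤ borelHeight (b : (quasiSplit (↥(maximalRealSubfield L)) L (IsCMField.complexConj L) 3).Adelic) →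
        ∀ u ∈ (fun v : adelicUnipotent (↥(maximalRealSubfield L)) L (IsCMField.complexConj L) 3 =>
            (⟨(β : (quasiSplit (↥(maximalRealSubfield L)) L (IsCMField.complexConj L) 3).Adelic)⁻¹ *
                (v : (quasiSplit (↥(maximalRealSubfield L)) L (IsCMField.complexConj L) 3).Adelic) *
                (β : (quasiSplit (↥(maximalRealSubfield L)) L (IsCMField.complexConj L) 3).Adelic),
              borel_inv_mul_mul_mem_adelicUnipotent β v⟩ :
              adelicUnipotent (↥(maximalRealSubfield L)) L (IsCMField.complexConj L) 3)) ''
            heisFundamentalDomain (↥(maximalRealSubfield L)) L (IsCMField.complexConj L) (complexConj_mul_complexConj L),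
          ∀ i j : Fin 3, i ≠ j → ∀ v : HeightOneSpectrum (𝓞 L),
            Valued.v ((((adelicVal (↥(maximalRealSubfield L)) L (IsCMField.complexConj L) 3 _
                ((b : (quasiSplit (↥(maximalRealSubfield L)) L (IsCMField.complexConj L) 3).Adelic)⁻¹ *
                  (u : (quasiSplit (↥(maximalRealSubfield L)) L (IsCMField.complexConj L) 3).Adelic) *
                  (b : (quasiSplit (↥(maximalRealSubfield L)) L (IsCMField.complexConj L) 3).Adelic)) :
              GL (Fin 3) (AdeleRing (𝓞 L) L)) : Matrix (Fin 3) (Fin 3) (AdeleRing (𝓞 L) L)) i j).2 v) ≤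
                idealRadius L v 𝔫 ∧
            Valued.v ((conjAdele (↥(maximalRealSubfield L)) L (IsCMField.complexConj L)
                (((adelicVal (↥(maximalRealSubfield L)) L (IsCMField.complexConj L) 3 _
                  ((b : (quasiSplit (↥(maximalRealSubfield L)) L (IsCMField.complexConj L) 3).Adelic)⁻¹ *
                    (u : (quasiSplit (↥(maximalRealSubfield L)) L (IsCMField.complexConj L) 3).Adelic) *
                    (b : (quasiSplit (↥(maximalRealSubfield L)) L (IsCMField.complexConj L) 3).Adelic)) :
              GL (Fin 3) (AdeleRing (𝓞 L) L)) : Matrix (Fin 3) (Fin 3) (AdeleRing (𝓞 L) L)) i j)).2 v) ≤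
                idealRadius L v 𝔫) :
    TruncatedKernelIntegrable (↥(maximalRealSubfield L)) L (IsCMField.complexConj L) :=
  truncatedKernelIntegrable_of_levelDepth (complexConj_mul_complexConj L) (IsCMField.complexConj_ne_one L)
    (Algebra.IsQuadraticExtension.finrank_eq_two (↥(maximalRealSubfield L)) L)
    (forall_isHaarMeasure_isMulRightInvariant_quasiSplit_cm_three L)
    (exists_mem_borelAdelic_mul_mem_standardMaximalCompactGL_cm_three L) hdepth

end UnitaryGroup

end Literature.NumberTheory.Automorphic
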